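/-
O(2) `{φ, s, t}` scan: rule (M) for the neutral sectors `0⁺`, `0⁻` on a BOX of external dimensions.
-/
import Literature.MathematicalPhysics.QuantumFieldTheory.O2DimBox
import Literature.MathematicalPhysics.QuantumFieldTheory.O2NeutralSectorsTail
import HarnessLib

/-!
# O(2) `{φ, s, t}` scan: rule (M) for the neutral sectors on a BOX of external dimensions

The tree's `termMatrix0p_posSemidef_on_box` / `termMatrix0m_posSemidef_on_box` (`O2NeutralSectorsTail`, §2)
decide `M^{0±}(E, j) ⪰ 0` for every `E ∈ [E₁, E₂]` at ONE external point `D = (Δ_s, Δ_φ, Δ_t)` from the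
closed-form corner numbers `cornerBound₂ c d z z̄ j E₁ E₂ s s` at `s = D.expo L` — the interval-matrix PSD
criterion of the sign–radius vertex matrices for the `3 × 3` sector `0⁺` and the three numbers `X, Y ≥ 0`,
`R² ≤ X Y` for the `2 × 2` sector `0⁻`.  Every entry of `M^{0±}(E, j)` is a two-weight evaluation
`twoWeightEval c d z z̄ (D.expo L) 𝒫_{E,j}` (`termMatrix0p/0m_apply_eq_twoWeightEval`) whose WEIGHTS do not
depend on `D`; only the exponent does, and on a box `lo ≤ D ≤ hi` of external dimensions it lies between its
corner values (`O2DimBox.expo_mem_Icc`; all fifteen printed exponents are half-sums).  Replacing `(s, s)` by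
`(lo.expo L, hi.expo L)` in the corner numbers (`O2DimBox.twoWeightEval_mem_Icc_corner_expo`) therefore gives
the SAME two rules UNIFORMLY IN `D` on the box, with the same reader-side data shape:

1. `dboxLo0p`, `dboxRad0p` and **`termMatrix0p_posSemidef_on_dbox`**: the sign–radius vertex matrices of the
   box numbers PSD ⇒ `M^{0+}_D(E, j) ⪰ 0` for every `D` in the box and every `E ∈ [E₁, E₂]`;
2. **`termMatrix0m_posSemidef_on_dbox`**: `X ≥ 0`, `Y ≥ 0`, `R² ≤ X Y` on the box numbers ⇒ `M^{0−}_D(E, j) ⪰ 0`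
   likewise;
3. the point rules are the case `lo = hi = D` (`dboxLo0p_self`, `dboxRad0p_self`).

This is the (M) half of the `D`-uniform layer for the neutral sectors (Chester et al. test finitely many
external points and triangulate, §3.3–§3.4; a certificate for a CELL of external dimensions needs every rule
uniformly on the cell); the apex rule (T) and the light rows on a `D`-box are separate items.
-/

noncomputable section

namespace Literature.MathematicalPhysics.QuantumFieldTheory.O2NeutralDimBox

open Set Finset Matrix
open Literature.MathematicalPhysics.QuantumFieldTheory.ConformalBootstrap3D
open O2ThreeScalarCrossing O2ThreeScalarSystem O2OPEScanBridge O2ScanObligations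
open O2NeutralSectorsTermwise O2NeutralSectorsHead O2NeutralSectorsCells O2NeutralSectorsTail O2DimBox
open Literature.Analysis.ValidatedNumerics.ParametricIntervalPosSemidef (signRadMatrix
  posSemidef_of_forall_signRadMatrix posSemidef_symm_fin_two_of_bounds)

/-- `lo ≤ x ≤ hi ⇒ |x| ≤ max (−lo) hi` (private helper). [folklore] -/
private theorem abs_le_max_of_mem' {x lo hi : ℝ} (h1 : lo ≤ x) (h2 : x ≤ hi) :
    |x| ≤ max (-lo) hi := by
  rw [abs_le]
  exact ⟨by linarith [le_max_left (-lo) hi], h2.trans (le_max_right _ _)⟩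

/-! ## 1. Sector `0⁺` on a box of external dimensions -/

/-- Lower corner numbers of the diagonal `0⁺` entries on `E ∈ [E₁, E₂]`, `lo ≤ D ≤ hi`:
`cb(c_ii, d_ii; j, E₁, E₂, lo.expo L_ii, hi.expo L_ii)`. [cite: HogervorstRychkov2013, §3 eq. (3.6)]
[cite: ChesterEtAl2020, §3.3 (scanning over external dimensions)] -/
def dboxLo0p (F : ScanFunctional) (lo hi : Dims) (j : ℕ) (E₁ E₂ : ℝ) : Fin 3 → ℝ := fun i =>
  cornerBound₂ (cw0p F i i) (dw0p F i i) F.z F.zb j E₁ E₂ (lo.expo (lab0p i i)) (hi.expo (lab0p i i))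

/-- Radius numbers of the `0⁺` entries on `E ∈ [E₁, E₂]`, `lo ≤ D ≤ hi`: `max(−cb(c,d), −cb(−c,−d))` at the
exponent interval `[lo.expo L, hi.expo L]`. [cite: HogervorstRychkov2013, §3 eq. (3.6)]
[cite: ChesterEtAl2020, §3.3 (scanning over external dimensions)] -/
def dboxRad0p (F : ScanFunctional) (lo hi : Dims) (j : ℕ) (E₁ E₂ : ℝ) : Matrix (Fin 3) (Fin 3) ℝ :=
  Matrix.of fun i k =>
    max (-cornerBound₂ (cw0p F i k) (dw0p F i k) F.z F.zb j E₁ E₂ (lo.expo (lab0p i k))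
          (hi.expo (lab0p i k)))
      (-cornerBound₂ (-cw0p F i k) (-dw0p F i k) F.z F.zb j E₁ E₂ (lo.expo (lab0p i k))
        (hi.expo (lab0p i k)))

/-- The point numbers are the degenerate box `lo = hi = D`. [cite: HogervorstRychkov2013, §3 eq. (3.6)] -/
theorem dboxLo0p_self (F : ScanFunctional) (D : Dims) (j : ℕ) (E₁ E₂ : ℝ) :
    dboxLo0p F D D j E₁ E₂ = boxLo0p F D j E₁ E₂ := rfl

/-- The point radii are the degenerate box `lo = hi = D`. [cite: HogervorstRychkov2013, §3 eq. (3.6)] -/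
theorem dboxRad0p_self (F : ScanFunctional) (D : Dims) (j : ℕ) (E₁ E₂ : ℝ) :
    dboxRad0p F D D j E₁ E₂ = boxRad0p F D j E₁ E₂ := rfl

/-- **Rule (M), sector `0⁺`, uniform on a box of external dimensions.** If the sign–radius vertex matrices
of the box numbers `(dboxLo0p, dboxRad0p)` are PSD then `M^{0+}_D(E, j)` is PSD for every `D` with
`lo ≤ D ≤ hi` and every `E ∈ [E₁, E₂]`. [cite: HogervorstRychkov2013, §3 eq. (3.6)]
[cite: Hladik2017, Thm. 1 ((2) ⇒ (1))] [cite: ChesterEtAl2020, §3.3 (scanning over external dimensions)] -/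
theorem termMatrix0p_posSemidef_on_dbox (F : ScanFunctional) {lo hi : Dims} (j : ℕ) {E₁ E₂ : ℝ}
    (hvert : ∀ z : Fin 3 → Bool,
      (signRadMatrix (dboxLo0p F lo hi j E₁ E₂) (dboxRad0p F lo hi j E₁ E₂) z).PosSemidef) :
    ∀ D, InDimBox lo hi D → ∀ E ∈ Icc E₁ E₂, (termMatrix0p F D E j).PosSemidef := by
  intro D hD E hE
  refine posSemidef_of_forall_signRadMatrix hvert (isHermitian_termMatrix0p F D E j) (fun i => ?_)
    (fun i k _ => ?_)
  · rw [termMatrix0p_apply_eq_twoWeightEval]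
    exact (twoWeightEval_mem_Icc_corner_expo F _ _ j hE hD _).1
  · rw [dboxRad0p, Matrix.of_apply, termMatrix0p_apply_eq_twoWeightEval]
    have h := twoWeightEval_mem_Icc_corner_expo F (cw0p F i k) (dw0p F i k) j hE hD (lab0p i k)
    exact abs_le_max_of_mem' h.1 h.2

/-- The same with the box read as the `Icc`-product `[lo.Δs, hi.Δs] × [lo.Δφ, hi.Δφ] × [lo.Δt, hi.Δt]`.
[cite: HogervorstRychkov2013, §3 eq. (3.6)] [cite: ChesterEtAl2020, §3.3 (scanning over external dimensions)] -/
theorem termMatrix0p_posSemidef_on_Icc (F : ScanFunctional) {lo hi : Dims} (j : ℕ) {E₁ E₂ : ℝ}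
    (hvert : ∀ z : Fin 3 → Bool,
      (signRadMatrix (dboxLo0p F lo hi j E₁ E₂) (dboxRad0p F lo hi j E₁ E₂) z).PosSemidef)
    {Δs Δφ Δt : ℝ} (h : (Δs, Δφ, Δt) ∈ Icc lo.Δs hi.Δs ×ˢ (Icc lo.Δφ hi.Δφ ×ˢ Icc lo.Δt hi.Δt)) :
    ∀ E ∈ Icc E₁ E₂, (termMatrix0p F ⟨Δs, Δφ, Δt⟩ E j).PosSemidef :=
  termMatrix0p_posSemidef_on_dbox F j hvert ⟨Δs, Δφ, Δt⟩
    (by simp only [Set.mem_prod, Set.mem_Icc] at h; exact ⟨h.1, h.2.1, h.2.2⟩)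

/-! ## 2. Sector `0⁻` on a box of external dimensions -/

/-- The box corner number of the `0⁻` entry `(i, k)` on `E ∈ [E₁, E₂]`, `lo ≤ D ≤ hi`.
[cite: HogervorstRychkov2013, §3 eq. (3.6)] [cite: ChesterEtAl2020, §3.3 (scanning over external dimensions)] -/
def dboxCb0m (F : ScanFunctional) (lo hi : Dims) (j : ℕ) (E₁ E₂ : ℝ) (i k : Fin 2) : ℝ :=
  cornerBound₂ (cw0m F i k) (dw0m F i k) F.z F.zb j E₁ E₂ (lo.expo (lab0m i k)) (hi.expo (lab0m i k))

/-- The box radius of the off-diagonal `0⁻` entry: `max(−cb(c₀₁,d₀₁), −cb(−c₀₁,−d₀₁))` at the exponent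
interval. [cite: HogervorstRychkov2013, §3 eq. (3.6)] [cite: ChesterEtAl2020, §3.3 (scanning over external dimensions)] -/
def dboxRad0m (F : ScanFunctional) (lo hi : Dims) (j : ℕ) (E₁ E₂ : ℝ) : ℝ :=
  max (-dboxCb0m F lo hi j E₁ E₂ 0 1)
    (-cornerBound₂ (-cw0m F 0 1) (-dw0m F 0 1) F.z F.zb j E₁ E₂ (lo.expo (lab0m 0 1))
      (hi.expo (lab0m 0 1)))

/-- **Rule (M), sector `0⁻`, uniform on a box of external dimensions** (closed form): with
`X = dboxCb0m 0 0`, `Y = dboxCb0m 1 1`, `R = dboxRad0m`, the checks `X ≥ 0`, `Y ≥ 0`, `R² ≤ X Y` give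
`M^{0−}_D(E, j)` PSD for every `D` with `lo ≤ D ≤ hi` and every `E ∈ [E₁, E₂]`.
[cite: HogervorstRychkov2013, §3 eq. (3.6)] [cite: ChesterEtAl2020, §3.3 (scanning over external dimensions)] -/
theorem termMatrix0m_posSemidef_on_dbox (F : ScanFunctional) {lo hi : Dims} (j : ℕ) {E₁ E₂ : ℝ}
    (hX : 0 ≤ dboxCb0m F lo hi j E₁ E₂ 0 0) (hY : 0 ≤ dboxCb0m F lo hi j E₁ E₂ 1 1)
    (hR : dboxRad0m F lo hi j E₁ E₂ ^ 2 ≤ dboxCb0m F lo hi j E₁ E₂ 0 0 * dboxCb0m F lo hi j E₁ E₂ 1 1) :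
    ∀ D, InDimBox lo hi D → ∀ E ∈ Icc E₁ E₂, (termMatrix0m F D E j).PosSemidef := by
  intro D hD E hE
  set A := termMatrix0m F D E j with hAdef
  have hsym : A 1 0 = A 0 1 := by
    have h := (isHermitian_termMatrix0m F D E j).apply 0 1
    rw [star_trivial] at h
    exact h
  have hA2 : A = !![A 0 0, A 0 1; A 0 1, A 1 1] := by
    ext i k; fin_cases i <;> fin_cases k <;> simp [hsym]
  have h00 := twoWeightEval_mem_Icc_corner_expo F (cw0m F 0 0) (dw0m F 0 0) j hE hD (lab0m 0 0)
  have h11 := twoWeightEval_mem_Icc_corner_expo F (cw0m F 1 1) (dw0m F 1 1) j hE hD (lab0m 1 1)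
  have h01 := twoWeightEval_mem_Icc_corner_expo F (cw0m F 0 1) (dw0m F 0 1) j hE hD (lab0m 0 1)
  have habs := abs_le_max_of_mem' h01.1 h01.2
  rw [← termMatrix0m_apply_eq_twoWeightEval] at h00 h11 habs
  rw [hA2]
  refine posSemidef_symm_fin_two_of_bounds hX hY ?_ h00.1 h11.1 ⟨neg_le_of_abs_le habs, le_of_abs_le habs⟩
  simp only [dboxRad0m, dboxCb0m] at hR ⊢
  rw [max_le_iff]
  constructor <;> nlinarith [hR]

/-- The same with the box read as the `Icc`-product `[lo.Δs, hi.Δs] × [lo.Δφ, hi.Δφ] × [lo.Δt, hi.Δt]`.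
[cite: HogervorstRychkov2013, §3 eq. (3.6)] [cite: ChesterEtAl2020, §3.3 (scanning over external dimensions)] -/
theorem termMatrix0m_posSemidef_on_Icc (F : ScanFunctional) {lo hi : Dims} (j : ℕ) {E₁ E₂ : ℝ}
    (hX : 0 ≤ dboxCb0m F lo hi j E₁ E₂ 0 0) (hY : 0 ≤ dboxCb0m F lo hi j E₁ E₂ 1 1)
    (hR : dboxRad0m F lo hi j E₁ E₂ ^ 2 ≤ dboxCb0m F lo hi j E₁ E₂ 0 0 * dboxCb0m F lo hi j E₁ E₂ 1 1)
    {Δs Δφ Δt : ℝ} (h : (Δs, Δφ, Δt) ∈ Icc lo.Δs hi.Δs ×ˢ (Icc lo.Δφ hi.Δφ ×ˢ Icc lo.Δt hi.Δt)) :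
    ∀ E ∈ Icc E₁ E₂, (termMatrix0m F ⟨Δs, Δφ, Δt⟩ E j).PosSemidef :=
  termMatrix0m_posSemidef_on_dbox F j hX hY hR ⟨Δs, Δφ, Δt⟩
    (by simp only [Set.mem_prod, Set.mem_Icc] at h; exact ⟨h.1, h.2.1, h.2.2⟩)

/-! ## 3. The point rules are the degenerate box -/

/-- The tree's point rule for `0⁺` is the case `lo = hi = D` of the box rule.
[cite: HogervorstRychkov2013, §3 eq. (3.6)] [cite: Hladik2017, Thm. 1 ((2) ⇒ (1))] -/
theorem termMatrix0p_posSemidef_on_box_of_dbox (F : ScanFunctional) (D : Dims) (j : ℕ) {E₁ E₂ : ℝ}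
    (hvert : ∀ z : Fin 3 → Bool,
      (signRadMatrix (boxLo0p F D j E₁ E₂) (boxRad0p F D j E₁ E₂) z).PosSemidef) :
    ∀ E ∈ Icc E₁ E₂, (termMatrix0p F D E j).PosSemidef :=
  termMatrix0p_posSemidef_on_dbox F j (lo := D) (hi := D) hvert D
    ⟨⟨le_rfl, le_rfl⟩, ⟨le_rfl, le_rfl⟩, ⟨le_rfl, le_rfl⟩⟩

end Literature.MathematicalPhysics.QuantumFieldTheory.O2NeutralDimBox
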